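import Summits.QuantumFields.BalabanUV.Beta.EriceRemainderEnclosureHistoryAutonomyComparisonAgeCompositionAdaptiveLevels
import Summits.QuantumFields.BalabanUV.Beta.EriceRemainderEnclosureHistoryAutonomyComparisonAgeCompositionFiveAgesOneBlockWide
import Summits.QuantumFields.BalabanUV.Beta.EriceRemainderEnclosureHistoryAutonomyComparisonAgeCompositionOldTripleCapC22
import Summits.QuantumFields.BalabanUV.Beta.EriceRemainderEnclosureHistoryAutonomyComparisonAgeCompositionOldTripleCapC23
import Summits.QuantumFields.BalabanUV.Beta.EriceRemainderEnclosureHistoryAutonomyComparisonAgeCompositionOldTripleCapC32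
import Summits.QuantumFields.BalabanUV.Beta.EriceRemainderEnclosureHistoryAutonomyComparisonAgeCompositionOldTripleCapC24
import Summits.QuantumFields.BalabanUV.Beta.EriceRemainderEnclosureHistoryAutonomyComparisonAgeCompositionOldTripleCapC42
import Summits.QuantumFields.BalabanUV.Beta.EriceRemainderEnclosureHistoryAutonomyComparisonAgeCompositionOldTripleCapC33
import Summits.QuantumFields.BalabanUV.Beta.EriceRemainderEnclosureHistoryAutonomyComparisonAgeCompositionOldTripleCapC34
import Summits.QuantumFields.BalabanUV.Beta.EriceRemainderEnclosureHistoryAutonomyComparisonAgeCompositionOldTripleCapC43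
import Summits.QuantumFields.BalabanUV.Beta.EriceRemainderEnclosureHistoryAutonomyComparisonAgeCompositionOldTripleCapC44
import Summits.QuantumFields.BalabanUV.Beta.EriceRemainderEnclosureHistoryAutonomyComparisonAgeCompositionOldTripleCapC28
import Summits.QuantumFields.BalabanUV.Beta.EriceRemainderEnclosureHistoryAutonomyComparisonAgeCompositionOldTripleCapC82
import Summits.QuantumFields.BalabanUV.Beta.EriceRemainderEnclosureHistoryAutonomyComparisonAgeCompositionOldTripleCapC38
import Summits.QuantumFields.BalabanUV.Beta.EriceRemainderEnclosureHistoryAutonomyComparisonAgeCompositionOldTripleCapC83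
import Summits.QuantumFields.BalabanUV.Beta.EriceRemainderEnclosureHistoryAutonomyComparisonAgeCompositionOldTripleCapC48
import Summits.QuantumFields.BalabanUV.Beta.EriceRemainderEnclosureHistoryAutonomyComparisonAgeCompositionOldTripleCapC84
import Summits.QuantumFields.BalabanUV.Beta.EriceRemainderEnclosureHistoryAutonomyComparisonAgeCompositionOldTripleCapC88

/-!
# EriceRemainderEnclosureHistoryAutonomyComparisonAgeCompositionFiveAgesFar — (E104e) route (N), first order: THE CENSUS FIVE AGES FOR EVERY YOUNG SECOND AGE, both top ratios at most 8.
# (E104a∕b) closed `{1,k₂,k₃,k₄,k₅}` for `2 ≤ k₂ ≤ 29` (the young pair's cap `0.8333` is typed only there).  For `k₂ ≥ 30` no pair cap is needed: take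
# THREE ADAPTIVE LEVELS `{1}`, `{k₂}`, `{k₃,k₄,k₅}` ((E101b) `flow_nonneg_adaptive_cluster_levels`) with overshoots `κ = (207∕500, 1∕5, 0)`: the young age's
# closure `0.7072·(1 + 207∕500) ≤ 1`, the middle one `4X₁(6∕5) + 1∕5 ≤ (207∕500)(1 − (6∕5)X₁)·k₂` (`X₁ ≤ 0.616`, `k₂ ≥ 30`: `3.157 ≤ 3.239`, as in g88's
# `…adaptive_far`), and the TOP one `k₂·4X₂ ≤ (1∕5)(1 − X₂)·k₃` with `X₂ = x_{k₃}+x_{k₄}+x_{k₅} ≤ s` the cell's triple cap — i.e. `20s·k₂ ≤ (1−s)·k₃`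
# (**`flow_nonneg_census_five_ages_far_of_cap`**, parametric in `s`).  Since `⌈20s∕(1−s)⌉` never exceeds the `ρ₀` of (E104a–c), the census five ages hold
# for EVERY `k₂ ≥ 2`: **`flow_nonneg_census_five_ages_top4_every`** (`68k₂ ≤ k₃`, `k₃ < k₄ ≤ 4k₃`, `k₄ < k₅ ≤ 4k₄`), **`…_top8_every`** (`233k₂ ≤ k₃`, both
# ratios ≤ 8); the `(8,16]` cells are the sequel (E104f).

Cell `pub-balaban`, β-function sub-cell, BINDER row D4 «RemainderConst leaves for Bałaban's split» (`HOME/BINDER-OWNERS.md`; owner lineage `b2b-balaban-beta-an4`;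
this file by co-owner #2 lineage `b2b-balaban-beta-d4-p2`, generation 89), β-FLOW TEAM duty (1), FREEZE (0) honoured (def-free; nothing restated).

HONEST FRAMING (page 1, verbatim and binding).  *"Discharging BetaPertH makes Bałaban's UV stability UNCONDITIONAL — a real constructive-QFT result; it is
NOT the continuum limit and NOT the Clay problem."*  THIS FILE DISCHARGES NOTHING OF THE KIND.  Elementary real algebra ∕ real analysis about ABSTRACT
functionals on a box ]0,γ]^ℕ with displayed floors, profiles and signs, and the FIRST-ORDER renewal objects of route (N) built from them — hypotheses of a
census, not facts; the form, signs, ages and moments of Bałaban's (1.22) limit functional are NOT PRINTED ([I] p. 298; GAPS G-t4-U2-1∕-2) and NOT asserted.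
Row D4 class UNCHANGED (critical-path width 0; instance 0∕1; D4 DISCHARGE NO DATE).  HONEST DEPENDENCY: continuum YM on T⁴ ⇐ BetaPertH ∧ nine spine
estimates (0/9 proved); BetaPertH ⇐ (D1) ∧ (D4) ∧ CAP+tail; G-an2-4 gates asym, D1 and NE2/3/4.

THE POINT (README `HOME/b2b-balaban-beta-d4-p2/g89/README.md` §4).  Uses (E101b) `flow_nonneg_adaptive_cluster_levels`, (E94b) `load_le_of_sq`, (E103) cell tables, (E104a∕b)
`flow_nonneg_census_five_ages_top4 ∕ _top8` BY NAME.  NOT CLAIMED: `k₃ < ρ₀k₂`; the cell `(8,16]²`; anything printed — NOT B12 Thm 2, NOT BetaPertH, NOT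
continuum, NOT Clay.

WHAT IS PROVED ([folklore]; 0 `def`, 0 sorry).  §1 `top_closure_of_gap`, **`flow_nonneg_census_five_ages_far_of_cap`**.  §2 `…_top4_far`, `…_top8_far`.  §3 **`…_top4_every`**,
**`…_top8_every`**.
-/
noncomputable section
open Finset

namespace Summit.QuantumFields.BalabanUV.Beta.EriceRemainderEnclosureHistoryAutonomyComparisonAgeCompositionFiveAgesFar

open Literature.MathematicalPhysics.QuantumFieldTheory.Balaban1983to89
open Literature.MathematicalPhysics.QuantumFieldTheory.Balaban1983to89.T4BetaStationary
open Literature.MathematicalPhysics.QuantumFieldTheory.Balaban1983to89.T4BetaFlowWellPosed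
open Summit.QuantumFields.BalabanUV.Beta.EriceRemainderEnclosureHistoryAutonomyComparisonAgeCompositionYoungPairMoment (load_le_of_sq)
open Summit.QuantumFields.BalabanUV.Beta.EriceRemainderEnclosureHistoryAutonomyComparisonAgeCompositionAdaptiveLevels (flow_nonneg_adaptive_cluster_levels)
open Summit.QuantumFields.BalabanUV.Beta.EriceRemainderEnclosureHistoryAutonomyComparisonAgeCompositionFiveAgesOneBlock (flow_nonneg_census_five_ages_top4)
open Summit.QuantumFields.BalabanUV.Beta.EriceRemainderEnclosureHistoryAutonomyComparisonAgeCompositionFiveAgesOneBlockWide (flow_nonneg_census_five_ages_top8)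
open Summit.QuantumFields.BalabanUV.Beta.EriceRemainderEnclosureHistoryAutonomyComparisonAgeCompositionOldTripleCapC22 (old_triple_load_le_c22)
open Summit.QuantumFields.BalabanUV.Beta.EriceRemainderEnclosureHistoryAutonomyComparisonAgeCompositionOldTripleCapC23 (old_triple_load_le_c23)
open Summit.QuantumFields.BalabanUV.Beta.EriceRemainderEnclosureHistoryAutonomyComparisonAgeCompositionOldTripleCapC32 (old_triple_load_le_c32)
open Summit.QuantumFields.BalabanUV.Beta.EriceRemainderEnclosureHistoryAutonomyComparisonAgeCompositionOldTripleCapC24 (old_triple_load_le_c24)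
open Summit.QuantumFields.BalabanUV.Beta.EriceRemainderEnclosureHistoryAutonomyComparisonAgeCompositionOldTripleCapC42 (old_triple_load_le_c42)
open Summit.QuantumFields.BalabanUV.Beta.EriceRemainderEnclosureHistoryAutonomyComparisonAgeCompositionOldTripleCapC33 (old_triple_load_le_c33)
open Summit.QuantumFields.BalabanUV.Beta.EriceRemainderEnclosureHistoryAutonomyComparisonAgeCompositionOldTripleCapC34 (old_triple_load_le_c34)
open Summit.QuantumFields.BalabanUV.Beta.EriceRemainderEnclosureHistoryAutonomyComparisonAgeCompositionOldTripleCapC43 (old_triple_load_le_c43)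
open Summit.QuantumFields.BalabanUV.Beta.EriceRemainderEnclosureHistoryAutonomyComparisonAgeCompositionOldTripleCapC44 (old_triple_load_le_c44)
open Summit.QuantumFields.BalabanUV.Beta.EriceRemainderEnclosureHistoryAutonomyComparisonAgeCompositionOldTripleCapC28 (old_triple_load_le_c28)
open Summit.QuantumFields.BalabanUV.Beta.EriceRemainderEnclosureHistoryAutonomyComparisonAgeCompositionOldTripleCapC82 (old_triple_load_le_c82)
open Summit.QuantumFields.BalabanUV.Beta.EriceRemainderEnclosureHistoryAutonomyComparisonAgeCompositionOldTripleCapC38 (old_triple_load_le_c38)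
open Summit.QuantumFields.BalabanUV.Beta.EriceRemainderEnclosureHistoryAutonomyComparisonAgeCompositionOldTripleCapC83 (old_triple_load_le_c83)
open Summit.QuantumFields.BalabanUV.Beta.EriceRemainderEnclosureHistoryAutonomyComparisonAgeCompositionOldTripleCapC48 (old_triple_load_le_c48)
open Summit.QuantumFields.BalabanUV.Beta.EriceRemainderEnclosureHistoryAutonomyComparisonAgeCompositionOldTripleCapC84 (old_triple_load_le_c84)
open Summit.QuantumFields.BalabanUV.Beta.EriceRemainderEnclosureHistoryAutonomyComparisonAgeCompositionOldTripleCapC88 (old_triple_load_le_c88)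

variable {B : (ℕ → ℝ) → ℝ} {γ b gIR : ℝ} {L : ℕ → ℝ} {K : ℕ} {h g : ℕ → ℝ}

/-! ## §1 Three adaptive levels: `{1}`, `{k₂}`, `{k₃,k₄,k₅}` (parametric in the triple cap) -/

/-- The top closure from a natural gap: `20s ≤ (1−s)R`, `s ≤ 1`, `R·k₂ ≤ k₃` give `20s·k₂ ≤ (1−s)·k₃`. [folklore] -/
theorem top_closure_of_gap {s : ℝ} {R k₂ k₃ : ℕ} (hRs : 20 * s ≤ (1 - s) * R) (hs1 : s ≤ 1) (hgap : R * k₂ ≤ k₃) :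
    20 * s * (k₂ : ℝ) ≤ (1 - s) * (k₃ : ℝ) := by
  have hg : ((R : ℝ)) * k₂ ≤ k₃ := by exact_mod_cast hgap
  have hk2 : (0 : ℝ) ≤ k₂ := Nat.cast_nonneg k₂
  calc 20 * s * (k₂ : ℝ) ≤ (1 - s) * R * k₂ := by nlinarith
    _ = (1 - s) * ((R : ℝ) * k₂) := by ring
    _ ≤ (1 - s) * k₃ := mul_le_mul_of_nonneg_left hg (by linarith)

/-- **THE CENSUS FIVE AGES FOR `k₂ ≥ 30` (parametric).**  Ages `{1, k₂, k₃, k₄, k₅}`, `30 ≤ k₂ < k₃ < k₄ < k₅ < K`, profile vanishing elsewhere; a triple cap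
`x_{k₃}(q)+x_{k₄}(q)+x_{k₅}(q) ≤ s` with `s < 1` (hypothesis) and the top closure `20s·k₂ ≤ (1−s)·k₃`.  THEN `0 ≤ ε ≤ e` at every pin, every horizon,
every damping of the self-consistent class ((E101b) with the levels `{1}, {k₂}, {k₃,k₄,k₅}` and `κ = (207∕500, 1∕5, 0)`). [folklore] -/
theorem flow_nonneg_census_five_ages_far_of_cap
    (hmono : ∀ u v : ℕ → ℝ, SeqBox γ u → SeqBox γ v → (∀ j, u j ≤ v j) → B u ≤ B v)
    (hL : ∀ k, 0 ≤ L k) (hb : 0 < b) (hlo : ∀ u, SeqBox γ u → b ≤ B u) (hdom : ∀ u, SeqBox γ u → ∑ k ∈ range K, L k * u k ≤ B u)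
    (hh : SeqBox γ h) (hf : MemFlow B gIR h) (hg : ∀ t, 0 < g t ∧ g t ≤ 1)
    (hgF : ∀ t, 1 ≤ g t * (1 + ∑ k ∈ range K, L k * h (t + k) ^ 3 / 2))
    {k₂ k₃ k₄ k₅ : ℕ} (hk2 : 30 ≤ k₂) (hk23 : k₂ < k₃) (hk34 : k₃ < k₄) (hk45 : k₄ < k₅) (hk5K : k₅ < K)
    {s : ℝ} (hs1 : s < 1) (hR : 20 * s * (k₂ : ℝ) ≤ (1 - s) * (k₃ : ℝ))
    (htri : ∀ q : ℕ, (k₃ : ℝ) * (L k₃ * h (q + k₃) ^ 3 / 2) + (k₄ : ℝ) * (L k₄ * h (q + k₄) ^ 3 / 2) + (k₅ : ℝ) * (L k₅ * h (q + k₅) ^ 3 / 2) ≤ s)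
    (hLa : ∀ l, l < K → l ≠ 1 → l ≠ k₂ → l ≠ k₃ → l ≠ k₄ → l ≠ k₅ → L l = 0)
    {N : ℕ} {KL : ℕ → ℕ → ℕ → ℝ}
    (hKL : ∀ k n l, KL k n l = if 0 < k ∧ k < K ∧ l < k then L k * h (n + k) ^ 3 / 2 * ∏ t ∈ Ico (n + 1 + l) (n + k + 1), g t else 0)
    {KA : ℕ → ℕ → ℕ → ℝ} {RA : ℕ → (ℕ → ℝ) → ℕ → ℝ}
    (hRA : ∀ i v m, RA i v m = ∑ l ∈ range K, KA i m l * v (m + 1 + l))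
    (hKA : ∀ i m l, KA i m l = KL i m l + KA (i + 1) m l) (hKAtop : ∀ m l, KA K m l = 0)
    {e ε : ℕ → ℝ} (he0 : ∀ m, 0 ≤ e m) (hea : ∀ m, e (m + 1) ≤ e m)
    (hεt : ∀ m, N < m → ε m = 0) (hεrec : ∀ m, ε m = e m - RA 1 ε m) : ∀ m, 0 ≤ ε m ∧ ε m ≤ e m := by
  have hpos : ∀ n, 0 < h n := fun n => (hh n).1
  have hk2r : (30 : ℝ) ≤ k₂ := by exact_mod_cast hk2
  -- the loads of the two young levels and their caps (E94b)
  obtain ⟨X₀, hX₀⟩ : ∃ X₀ : ℕ → ℝ, ∀ q, X₀ q = L 1 * h (q + 1) ^ 3 / 2 := ⟨_, fun _ => rfl⟩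
  obtain ⟨X₁, hX₁⟩ : ∃ X₁ : ℕ → ℝ, ∀ q, X₁ q = (k₂ : ℝ) * (L k₂ * h (q + k₂) ^ 3 / 2) := ⟨_, fun _ => rfl⟩
  have hX0c : ∀ q, X₀ q ≤ 7072 / 10000 := fun q => by
    rw [hX₀]
    have := load_le_of_sq hmono hL hb hlo hdom hh hf (k := 1) le_rfl (by omega) (so := 7072 / 10000) (by norm_num) (by norm_num) q
    simpa using this
  have hX1c : ∀ q, 0 ≤ X₁ q ∧ X₁ q ≤ 77 / 125 := fun q => by
    refine ⟨by rw [hX₁]; have := hL k₂; have := hpos (q + k₂); positivity, ?_⟩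
    rw [hX₁]; exact load_le_of_sq hmono hL hb hlo hdom hh hf (by omega) (by omega) (so := 77 / 125) (by norm_num) (by nlinarith) q
  have hX2c : ∀ q, 0 ≤ (k₃ : ℝ) * (L k₃ * h (q + k₃) ^ 3 / 2) + (k₄ : ℝ) * (L k₄ * h (q + k₄) ^ 3 / 2) + (k₅ : ℝ) * (L k₅ * h (q + k₅) ^ 3 / 2) :=
    fun q => by have := hL k₃; have := hL k₄; have := hL k₅; have := hpos (q + k₃); have := hpos (q + k₄); have := hpos (q + k₅); positivity
  -- the levels and the overshoots
  obtain ⟨S, hS⟩ : ∃ S : ℕ → Finset ℕ, ∀ j, S j = if j = 0 then {1} else if j = 1 then {k₂} else {k₃, k₄, k₅} := ⟨_, fun _ => rfl⟩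
  obtain ⟨LO, hLO⟩ : ∃ LO : ℕ → ℕ, ∀ j, LO j = if j = 0 then 1 else if j = 1 then k₂ else k₃ := ⟨_, fun _ => rfl⟩
  obtain ⟨HI, hHI⟩ : ∃ HI : ℕ → ℕ, ∀ j, HI j = if j = 0 then 1 else if j = 1 then k₂ else k₅ := ⟨_, fun _ => rfl⟩
  obtain ⟨κ, hκ⟩ : ∃ κ : ℕ → ℕ → ℝ, ∀ j (q : ℕ), κ j q = if j = 0 then 207 / 500 else if j = 1 then 1 / 5 else 0 := ⟨_, fun _ _ => rfl⟩
  have hS0 : S 0 = {1} := by rw [hS]; simp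
  have hS1 : S 1 = {k₂} := by rw [hS]; simp
  have hS2 : S 2 = {k₃, k₄, k₅} := by rw [hS]; simp
  have hLO0 : LO 0 = 1 := by rw [hLO]; simp
  have hLO1 : LO 1 = k₂ := by rw [hLO]; simp
  have hLO2 : LO 2 = k₃ := by rw [hLO]; simp
  have hHI0 : HI 0 = 1 := by rw [hHI]; simp
  have hHI1 : HI 1 = k₂ := by rw [hHI]; simp
  have hHI2 : HI 2 = k₅ := by rw [hHI]; simp
  have hκ0v : ∀ q, κ 0 q = 207 / 500 := fun q => by rw [hκ]; simp
  have hκ1v : ∀ q, κ 1 q = 1 / 5 := fun q => by rw [hκ]; simp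
  have hκ2v : ∀ q, κ 2 q = 0 := fun q => by rw [hκ]; simp
  -- members and bounds of the three levels
  have hmem : ∀ j, j < 3 → ∀ k ∈ S j, 1 ≤ k ∧ k < K ∧ LO j ≤ k ∧ k ≤ HI j := by
    intro j hj k hk
    interval_cases j
    · rw [hS0, mem_singleton] at hk; rw [hLO0, hHI0]; omega
    · rw [hS1, mem_singleton] at hk; rw [hLO1, hHI1]; omega
    · rw [hS2] at hk; simp only [mem_insert, mem_singleton] at hk; rw [hLO2, hHI2]; rcases hk with rfl | rfl | rfl <;> omega
  refine flow_nonneg_adaptive_cluster_levels hmono hL hb hlo hdom hh hf hg hgF (by omega) (r := 3) (S := S) (lo := LO) (hi := HI) (κ := κ)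
    (fun j q => ?_) (fun j hj k hk => ⟨(hmem j hj k hk).1, (hmem j hj k hk).2.1⟩) (fun j hj k hk => (hmem j hj k hk).2.2.1)
    (fun j hj k hk => (hmem j hj k hk).2.2.2) (fun j hj1 hjr => ?_) (fun j hj1 hjr => ?_)
    (fun j hj => ?_) (fun i j hij hjr => ?_) (fun l hl hno => ?_) (fun q => ?_) (fun j q hj1 hjr => ?_) hKL hRA hKA hKAtop he0 hea hεt hεrec
  · -- overshoots are non-negative
    rcases Nat.lt_or_ge j 3 with hj | hj
    · interval_cases j
      · rw [hκ0v]; norm_num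
      · rw [hκ1v]; norm_num
      · rw [hκ2v]
    · rw [hκ, if_neg (by omega), if_neg (by omega)]
  · -- lo ≤ hi
    have : j = 1 ∨ j = 2 := by omega
    rcases this with rfl | rfl
    · rw [hLO1, hHI1]
    · rw [hLO2, hHI2]; omega
  · -- 1 ≤ lo
    have : j = 1 ∨ j = 2 := by omega
    rcases this with rfl | rfl
    · rw [hLO1]; omega
    · rw [hLO2]; omega
  · -- nested: hi j ≤ lo (j+1)
    have : j = 0 ∨ j = 1 := by omega
    rcases this with rfl | rfl
    · rw [hHI0, hLO1]; omega
    · rw [hHI1, hLO2]; omega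
  · -- pairwise disjoint: every member of level i lies below every member of level j
    exact disjoint_left.mpr fun x hx hx' => by
      have h1 := (hmem i (by omega) x hx).2.2.2
      have h2 := (hmem j hjr x hx').2.2.1
      have : (i = 0 ∧ j = 1) ∨ (i = 0 ∧ j = 2) ∨ (i = 1 ∧ j = 2) := by omega
      rcases this with ⟨rfl, rfl⟩ | ⟨rfl, rfl⟩ | ⟨rfl, rfl⟩
      · rw [hHI0] at h1; rw [hLO1] at h2; omega
      · rw [hHI0] at h1; rw [hLO2] at h2; omega
      · rw [hHI1] at h1; rw [hLO2] at h2; omega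
  · -- the profile vanishes off the five ages
    have h0 := hno 0 (by omega); have h1 := hno 1 (by omega); have h2 := hno 2 (by omega)
    rw [hS0, mem_singleton] at h0
    rw [hS1, mem_singleton] at h1
    rw [hS2] at h2; simp only [mem_insert, mem_singleton, not_or] at h2
    exact hLa l hl h0 h1 h2.1 h2.2.1 h2.2.2
  · -- the young age's closure
    rw [hS0, hκ0v, sum_singleton, Nat.cast_one, one_mul]
    have := hX0c q; rw [hX₀] at this
    nlinarith [this]
  · -- the two older levels
    have : j = 1 ∨ j = 2 := by omega
    rcases this with rfl | rfl
    · -- {k₂}: 4X₁(6∕5) + 1∕5 ≤ (207∕500)(1 − (6∕5)X₁)·k₂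
      rw [hS1, sum_singleton, show (1 : ℕ) - 1 = 0 from rfl, hHI0, hLO1, hκ0v, hκ1v, ← hX₁, Nat.cast_one, one_mul]
      have h1c := hX1c q
      refine ⟨by nlinarith [h1c.2], ?_⟩
      have hp := mul_le_mul hk2r (show (163 : ℝ) / 625 ≤ 1 - X₁ q * (1 + 1 / 5) by linarith [h1c.2]) (by norm_num) (Nat.cast_nonneg k₂)
      linarith [hp, h1c.1, h1c.2]
    · -- {k₃,k₄,k₅}: the top closure k₂·4X₂ ≤ (1∕5)(1 − X₂)·k₃ from X₂ ≤ s and 20s·k₂ ≤ (1−s)·k₃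
      rw [hS2, show (2 : ℕ) - 1 = 1 from rfl, hHI1, hLO2, hκ1v, hκ2v, sum_insert (by simp; omega), sum_pair (show k₄ ≠ k₅ by omega)]
      have ht := htri q
      have h0 := hX2c q
      have hk2n : (0 : ℝ) ≤ k₂ := Nat.cast_nonneg k₂
      have hk3n : (0 : ℝ) ≤ k₃ := Nat.cast_nonneg k₃
      refine ⟨by linarith, ?_⟩
      have e1 : (k₂ : ℝ) * (4 * ((k₃ : ℝ) * (L k₃ * h (q + k₃) ^ 3 / 2) + ((k₄ : ℝ) * (L k₄ * h (q + k₄) ^ 3 / 2)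
          + (k₅ : ℝ) * (L k₅ * h (q + k₅) ^ 3 / 2))) * (1 + 0) + 0) ≤ (k₂ : ℝ) * (4 * s) := by
        apply mul_le_mul_of_nonneg_left _ hk2n; linarith
      have e2 : 1 / 5 * (1 - s) * (k₃ : ℝ) ≤ 1 / 5 * (1 - ((k₃ : ℝ) * (L k₃ * h (q + k₃) ^ 3 / 2) + ((k₄ : ℝ) * (L k₄ * h (q + k₄) ^ 3 / 2)
          + (k₅ : ℝ) * (L k₅ * h (q + k₅) ^ 3 / 2))) * (1 + 0)) * (k₃ : ℝ) := by
        apply mul_le_mul_of_nonneg_right _ hk3n; linarith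
      linarith [e1, e2, hR]

/-! ## §2 The unions for `k₂ ≥ 30` -/

/-- **FIVE AGES, `k₂ ≥ 30`, BOTH TOP RATIOS AT MOST 4.**  `30 ≤ k₂`, `68k₂ ≤ k₃`, `k₃ < k₄ ≤ 4k₃`, `k₄ < k₅ ≤ 4k₄`, `k₅ < K`: `0 ≤ ε ≤ e` at every pin
(§1 with the nine cell caps; `20s∕(1−s) ≤ 60 ∕ 64 ∕ 67`). [folklore] -/
theorem flow_nonneg_census_five_ages_top4_far
    (hmono : ∀ u v : ℕ → ℝ, SeqBox γ u → SeqBox γ v → (∀ j, u j ≤ v j) → B u ≤ B v)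
    (hL : ∀ k, 0 ≤ L k) (hb : 0 < b) (hlo : ∀ u, SeqBox γ u → b ≤ B u) (hdom : ∀ u, SeqBox γ u → ∑ k ∈ range K, L k * u k ≤ B u)
    (hh : SeqBox γ h) (hf : MemFlow B gIR h) (hg : ∀ t, 0 < g t ∧ g t ≤ 1)
    (hgF : ∀ t, 1 ≤ g t * (1 + ∑ k ∈ range K, L k * h (t + k) ^ 3 / 2))
    {k₂ k₃ k₄ k₅ : ℕ} (hk2 : 30 ≤ k₂) (hk3 : 68 * k₂ ≤ k₃)
    (h34l : k₃ < k₄) (h34h : k₄ ≤ 4 * k₃) (h45l : k₄ < k₅) (h45h : k₅ ≤ 4 * k₄) (hk5K : k₅ < K)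
    (hLa : ∀ l, l < K → l ≠ 1 → l ≠ k₂ → l ≠ k₃ → l ≠ k₄ → l ≠ k₅ → L l = 0)
    {N : ℕ} {KL : ℕ → ℕ → ℕ → ℝ}
    (hKL : ∀ k n l, KL k n l = if 0 < k ∧ k < K ∧ l < k then L k * h (n + k) ^ 3 / 2 * ∏ t ∈ Ico (n + 1 + l) (n + k + 1), g t else 0)
    {KA : ℕ → ℕ → ℕ → ℝ} {RA : ℕ → (ℕ → ℝ) → ℕ → ℝ}
    (hRA : ∀ i v m, RA i v m = ∑ l ∈ range K, KA i m l * v (m + 1 + l))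
    (hKA : ∀ i m l, KA i m l = KL i m l + KA (i + 1) m l) (hKAtop : ∀ m l, KA K m l = 0)
    {e ε : ℕ → ℝ} (he0 : ∀ m, 0 ≤ e m) (hea : ∀ m, e (m + 1) ≤ e m)
    (hεt : ∀ m, N < m → ε m = 0) (hεrec : ∀ m, ε m = e m - RA 1 ε m) : ∀ m, 0 ≤ ε m ∧ ε m ≤ e m := by
  rcases le_or_gt k₄ (2 * k₃) with ha | ha
  · rcases le_or_gt k₅ (2 * k₄) with hb' | hb'
    · exact flow_nonneg_census_five_ages_far_of_cap hmono hL hb hlo hdom hh hf hg hgF hk2 (by omega) (by omega) (by omega) hk5K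
          (s := 3 / 4) (by norm_num) (top_closure_of_gap (R := 60) (by norm_num) (by norm_num) (by omega))
          (fun q => old_triple_load_le_c22 hmono hL hb hlo hdom hh hf (by omega) (by omega) ha (by omega) hb' hk5K q) hLa hKL hRA hKA hKAtop he0 hea hεt hεrec
    rcases le_or_gt k₅ (3 * k₄) with hc | hc
    · exact flow_nonneg_census_five_ages_far_of_cap hmono hL hb hlo hdom hh hf hg hgF hk2 (by omega) (by omega) (by omega) hk5K
          (s := 3 / 4) (by norm_num) (top_closure_of_gap (R := 60) (by norm_num) (by norm_num) (by omega))
          (fun q => old_triple_load_le_c23 hmono hL hb hlo hdom hh hf (by omega) (by omega) ha hb' hc hk5K q) hLa hKL hRA hKA hKAtop he0 hea hεt hεrec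
    · exact flow_nonneg_census_five_ages_far_of_cap hmono hL hb hlo hdom hh hf hg hgF hk2 (by omega) (by omega) (by omega) hk5K
          (s := 3 / 4) (by norm_num) (top_closure_of_gap (R := 60) (by norm_num) (by norm_num) (by omega))
          (fun q => old_triple_load_le_c24 hmono hL hb hlo hdom hh hf (by omega) (by omega) ha hc h45h hk5K q) hLa hKL hRA hKA hKAtop he0 hea hεt hεrec
  rcases le_or_gt k₄ (3 * k₃) with ha2 | ha2
  · rcases le_or_gt k₅ (2 * k₄) with hb' | hb'
    · exact flow_nonneg_census_five_ages_far_of_cap hmono hL hb hlo hdom hh hf hg hgF hk2 (by omega) (by omega) (by omega) hk5K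
          (s := 3 / 4) (by norm_num) (top_closure_of_gap (R := 60) (by norm_num) (by norm_num) (by omega))
          (fun q => old_triple_load_le_c32 hmono hL hb hlo hdom hh hf (by omega) ha ha2 (by omega) hb' hk5K q) hLa hKL hRA hKA hKAtop he0 hea hεt hεrec
    rcases le_or_gt k₅ (3 * k₄) with hc | hc
    · exact flow_nonneg_census_five_ages_far_of_cap hmono hL hb hlo hdom hh hf hg hgF hk2 (by omega) (by omega) (by omega) hk5K
          (s := 19 / 25) (by norm_num) (top_closure_of_gap (R := 64) (by norm_num) (by norm_num) (by omega))
          (fun q => old_triple_load_le_c33 hmono hL hb hlo hdom hh hf (by omega) ha ha2 hb' hc hk5K q) hLa hKL hRA hKA hKAtop he0 hea hεt hεrec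
    · exact flow_nonneg_census_five_ages_far_of_cap hmono hL hb hlo hdom hh hf hg hgF hk2 (by omega) (by omega) (by omega) hk5K
          (s := 77 / 100) (by norm_num) (top_closure_of_gap (R := 67) (by norm_num) (by norm_num) (by omega))
          (fun q => old_triple_load_le_c34 hmono hL hb hlo hdom hh hf (by omega) ha ha2 hc h45h hk5K q) hLa hKL hRA hKA hKAtop he0 hea hεt hεrec
  · rcases le_or_gt k₅ (2 * k₄) with hb' | hb'
    · exact flow_nonneg_census_five_ages_far_of_cap hmono hL hb hlo hdom hh hf hg hgF hk2 (by omega) (by omega) (by omega) hk5K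
          (s := 19 / 25) (by norm_num) (top_closure_of_gap (R := 64) (by norm_num) (by norm_num) (by omega))
          (fun q => old_triple_load_le_c42 hmono hL hb hlo hdom hh hf (by omega) ha2 h34h (by omega) hb' hk5K q) hLa hKL hRA hKA hKAtop he0 hea hεt hεrec
    rcases le_or_gt k₅ (3 * k₄) with hc | hc
    · exact flow_nonneg_census_five_ages_far_of_cap hmono hL hb hlo hdom hh hf hg hgF hk2 (by omega) (by omega) (by omega) hk5K
          (s := 77 / 100) (by norm_num) (top_closure_of_gap (R := 67) (by norm_num) (by norm_num) (by omega))
          (fun q => old_triple_load_le_c43 hmono hL hb hlo hdom hh hf (by omega) ha2 h34h hb' hc hk5K q) hLa hKL hRA hKA hKAtop he0 hea hεt hεrec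
    · exact flow_nonneg_census_five_ages_far_of_cap hmono hL hb hlo hdom hh hf hg hgF hk2 (by omega) (by omega) (by omega) hk5K
          (s := 77 / 100) (by norm_num) (top_closure_of_gap (R := 67) (by norm_num) (by norm_num) (by omega))
          (fun q => old_triple_load_le_c44 hmono hL hb hlo hdom hh hf (by omega) ha2 h34h hc h45h hk5K q) hLa hKL hRA hKA hKAtop he0 hea hεt hεrec

/-- **FIVE AGES, `k₂ ≥ 30`, BOTH TOP RATIOS AT MOST 8.**  `30 ≤ k₂`, `233k₂ ≤ k₃`, `k₃ < k₄ ≤ 8k₃`, `k₄ < k₅ ≤ 8k₄`, `k₅ < K`: `0 ≤ ε ≤ e` at every pin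
(`…_top4_far` and seven cells; `20s∕(1−s) ≤ 230`). [folklore] -/
theorem flow_nonneg_census_five_ages_top8_far
    (hmono : ∀ u v : ℕ → ℝ, SeqBox γ u → SeqBox γ v → (∀ j, u j ≤ v j) → B u ≤ B v)
    (hL : ∀ k, 0 ≤ L k) (hb : 0 < b) (hlo : ∀ u, SeqBox γ u → b ≤ B u) (hdom : ∀ u, SeqBox γ u → ∑ k ∈ range K, L k * u k ≤ B u)
    (hh : SeqBox γ h) (hf : MemFlow B gIR h) (hg : ∀ t, 0 < g t ∧ g t ≤ 1)
    (hgF : ∀ t, 1 ≤ g t * (1 + ∑ k ∈ range K, L k * h (t + k) ^ 3 / 2))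
    {k₂ k₃ k₄ k₅ : ℕ} (hk2 : 30 ≤ k₂) (hk3 : 233 * k₂ ≤ k₃)
    (h34l : k₃ < k₄) (h34h : k₄ ≤ 8 * k₃) (h45l : k₄ < k₅) (h45h : k₅ ≤ 8 * k₄) (hk5K : k₅ < K)
    (hLa : ∀ l, l < K → l ≠ 1 → l ≠ k₂ → l ≠ k₃ → l ≠ k₄ → l ≠ k₅ → L l = 0)
    {N : ℕ} {KL : ℕ → ℕ → ℕ → ℝ}
    (hKL : ∀ k n l, KL k n l = if 0 < k ∧ k < K ∧ l < k then L k * h (n + k) ^ 3 / 2 * ∏ t ∈ Ico (n + 1 + l) (n + k + 1), g t else 0)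
    {KA : ℕ → ℕ → ℕ → ℝ} {RA : ℕ → (ℕ → ℝ) → ℕ → ℝ}
    (hRA : ∀ i v m, RA i v m = ∑ l ∈ range K, KA i m l * v (m + 1 + l))
    (hKA : ∀ i m l, KA i m l = KL i m l + KA (i + 1) m l) (hKAtop : ∀ m l, KA K m l = 0)
    {e ε : ℕ → ℝ} (he0 : ∀ m, 0 ≤ e m) (hea : ∀ m, e (m + 1) ≤ e m)
    (hεt : ∀ m, N < m → ε m = 0) (hεrec : ∀ m, ε m = e m - RA 1 ε m) : ∀ m, 0 ≤ ε m ∧ ε m ≤ e m := by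
  rcases le_or_gt k₄ (4 * k₃) with ha | ha
  · rcases le_or_gt k₅ (4 * k₄) with hb' | hb'
    · exact flow_nonneg_census_five_ages_top4_far hmono hL hb hlo hdom hh hf hg hgF hk2 (by omega) h34l ha h45l hb' hk5K hLa hKL hRA hKA hKAtop he0 hea hεt hεrec
    rcases le_or_gt k₄ (2 * k₃) with h2 | h2
    · exact flow_nonneg_census_five_ages_far_of_cap hmono hL hb hlo hdom hh hf hg hgF hk2 (by omega) (by omega) (by omega) hk5K
          (s := 81 / 100) (by norm_num) (top_closure_of_gap (R := 86) (by norm_num) (by norm_num) (by omega))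
          (fun q => old_triple_load_le_c28 hmono hL hb hlo hdom hh hf (by omega) (by omega) h2 hb' h45h hk5K q) hLa hKL hRA hKA hKAtop he0 hea hεt hεrec
    rcases le_or_gt k₄ (3 * k₃) with h3 | h3
    · exact flow_nonneg_census_five_ages_far_of_cap hmono hL hb hlo hdom hh hf hg hgF hk2 (by omega) (by omega) (by omega) hk5K
          (s := 41 / 50) (by norm_num) (top_closure_of_gap (R := 92) (by norm_num) (by norm_num) (by omega))
          (fun q => old_triple_load_le_c38 hmono hL hb hlo hdom hh hf (by omega) h2 h3 hb' h45h hk5K q) hLa hKL hRA hKA hKAtop he0 hea hεt hεrec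
    · exact flow_nonneg_census_five_ages_far_of_cap hmono hL hb hlo hdom hh hf hg hgF hk2 (by omega) (by omega) (by omega) hk5K
          (s := 21 / 25) (by norm_num) (top_closure_of_gap (R := 105) (by norm_num) (by norm_num) (by omega))
          (fun q => old_triple_load_le_c48 hmono hL hb hlo hdom hh hf (by omega) h3 ha hb' h45h hk5K q) hLa hKL hRA hKA hKAtop he0 hea hεt hεrec
  rcases le_or_gt k₅ (2 * k₄) with h2 | h2
  · exact flow_nonneg_census_five_ages_far_of_cap hmono hL hb hlo hdom hh hf hg hgF hk2 (by omega) (by omega) (by omega) hk5K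
        (s := 41 / 50) (by norm_num) (top_closure_of_gap (R := 92) (by norm_num) (by norm_num) (by omega))
        (fun q => old_triple_load_le_c82 hmono hL hb hlo hdom hh hf (by omega) ha h34h (by omega) h2 hk5K q) hLa hKL hRA hKA hKAtop he0 hea hεt hεrec
  rcases le_or_gt k₅ (3 * k₄) with h3 | h3
  · exact flow_nonneg_census_five_ages_far_of_cap hmono hL hb hlo hdom hh hf hg hgF hk2 (by omega) (by omega) (by omega) hk5K
        (s := 21 / 25) (by norm_num) (top_closure_of_gap (R := 105) (by norm_num) (by norm_num) (by omega))
        (fun q => old_triple_load_le_c83 hmono hL hb hlo hdom hh hf (by omega) ha h34h h2 h3 hk5K q) hLa hKL hRA hKA hKAtop he0 hea hεt hεrec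
  rcases le_or_gt k₅ (4 * k₄) with h4 | h4
  · exact flow_nonneg_census_five_ages_far_of_cap hmono hL hb hlo hdom hh hf hg hgF hk2 (by omega) (by omega) (by omega) hk5K
        (s := 17 / 20) (by norm_num) (top_closure_of_gap (R := 114) (by norm_num) (by norm_num) (by omega))
        (fun q => old_triple_load_le_c84 hmono hL hb hlo hdom hh hf (by omega) ha h34h h3 h4 hk5K q) hLa hKL hRA hKA hKAtop he0 hea hεt hεrec
  · exact flow_nonneg_census_five_ages_far_of_cap hmono hL hb hlo hdom hh hf hg hgF hk2 (by omega) (by omega) (by omega) hk5K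
        (s := 23 / 25) (by norm_num) (top_closure_of_gap (R := 230) (by norm_num) (by norm_num) (by omega))
        (fun q => old_triple_load_le_c88 hmono hL hb hlo hdom hh hf (by omega) ha h34h h4 h45h hk5K q) hLa hKL hRA hKA hKAtop he0 hea hεt hεrec

/-! ## §3 Every young second age -/

/-- **THE CENSUS FIVE AGES `{1,k₂,k₃,k₄,k₅}` FOR EVERY `k₂ ≥ 2`, BOTH TOP RATIOS AT MOST 4.**  `2 ≤ k₂`, `68k₂ ≤ k₃`, `k₃ < k₄ ≤ 4k₃`, `k₄ < k₅ ≤ 4k₄`, `k₅ < K`: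
`0 ≤ ε ≤ e` at every pin, every horizon, every damping of the self-consistent class ((E104a) for `k₂ ≤ 29`, §2 for `k₂ ≥ 30`). [folklore] -/
theorem flow_nonneg_census_five_ages_top4_every
    (hmono : ∀ u v : ℕ → ℝ, SeqBox γ u → SeqBox γ v → (∀ j, u j ≤ v j) → B u ≤ B v)
    (hL : ∀ k, 0 ≤ L k) (hb : 0 < b) (hlo : ∀ u, SeqBox γ u → b ≤ B u) (hdom : ∀ u, SeqBox γ u → ∑ k ∈ range K, L k * u k ≤ B u)
    (hh : SeqBox γ h) (hf : MemFlow B gIR h) (hg : ∀ t, 0 < g t ∧ g t ≤ 1)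
    (hgF : ∀ t, 1 ≤ g t * (1 + ∑ k ∈ range K, L k * h (t + k) ^ 3 / 2))
    {k₂ k₃ k₄ k₅ : ℕ} (hk2 : 2 ≤ k₂) (hk3 : 68 * k₂ ≤ k₃)
    (h34l : k₃ < k₄) (h34h : k₄ ≤ 4 * k₃) (h45l : k₄ < k₅) (h45h : k₅ ≤ 4 * k₄) (hk5K : k₅ < K)
    (hLa : ∀ l, l < K → l ≠ 1 → l ≠ k₂ → l ≠ k₃ → l ≠ k₄ → l ≠ k₅ → L l = 0)
    {N : ℕ} {KL : ℕ → ℕ → ℕ → ℝ}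
    (hKL : ∀ k n l, KL k n l = if 0 < k ∧ k < K ∧ l < k then L k * h (n + k) ^ 3 / 2 * ∏ t ∈ Ico (n + 1 + l) (n + k + 1), g t else 0)
    {KA : ℕ → ℕ → ℕ → ℝ} {RA : ℕ → (ℕ → ℝ) → ℕ → ℝ}
    (hRA : ∀ i v m, RA i v m = ∑ l ∈ range K, KA i m l * v (m + 1 + l))
    (hKA : ∀ i m l, KA i m l = KL i m l + KA (i + 1) m l) (hKAtop : ∀ m l, KA K m l = 0)
    {e ε : ℕ → ℝ} (he0 : ∀ m, 0 ≤ e m) (hea : ∀ m, e (m + 1) ≤ e m)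
    (hεt : ∀ m, N < m → ε m = 0) (hεrec : ∀ m, ε m = e m - RA 1 ε m) : ∀ m, 0 ≤ ε m ∧ ε m ≤ e m := by
  rcases le_or_gt k₂ 29 with h29 | h30
  · exact flow_nonneg_census_five_ages_top4 hmono hL hb hlo hdom hh hf hg hgF hk2 h29 hk3 h34l h34h h45l h45h hk5K hLa hKL hRA hKA hKAtop he0 hea hεt hεrec
  · exact flow_nonneg_census_five_ages_top4_far hmono hL hb hlo hdom hh hf hg hgF (by omega) hk3 h34l h34h h45l h45h hk5K hLa hKL hRA hKA hKAtop he0 hea hεt hεrec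

/-- **THE CENSUS FIVE AGES FOR EVERY `k₂ ≥ 2`, BOTH TOP RATIOS AT MOST 8.**  `2 ≤ k₂`, `233k₂ ≤ k₃`, `k₃ < k₄ ≤ 8k₃`, `k₄ < k₅ ≤ 8k₄`, `k₅ < K`: `0 ≤ ε ≤ e` at
every pin ((E104b) for `k₂ ≤ 29`, §2 for `k₂ ≥ 30`). [folklore] -/
theorem flow_nonneg_census_five_ages_top8_every
    (hmono : ∀ u v : ℕ → ℝ, SeqBox γ u → SeqBox γ v → (∀ j, u j ≤ v j) → B u ≤ B v)
    (hL : ∀ k, 0 ≤ L k) (hb : 0 < b) (hlo : ∀ u, SeqBox γ u → b ≤ B u) (hdom : ∀ u, SeqBox γ u → ∑ k ∈ range K, L k * u k ≤ B u)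
    (hh : SeqBox γ h) (hf : MemFlow B gIR h) (hg : ∀ t, 0 < g t ∧ g t ≤ 1)
    (hgF : ∀ t, 1 ≤ g t * (1 + ∑ k ∈ range K, L k * h (t + k) ^ 3 / 2))
    {k₂ k₃ k₄ k₅ : ℕ} (hk2 : 2 ≤ k₂) (hk3 : 233 * k₂ ≤ k₃)
    (h34l : k₃ < k₄) (h34h : k₄ ≤ 8 * k₃) (h45l : k₄ < k₅) (h45h : k₅ ≤ 8 * k₄) (hk5K : k₅ < K)
    (hLa : ∀ l, l < K → l ≠ 1 → l ≠ k₂ → l ≠ k₃ → l ≠ k₄ → l ≠ k₅ → L l = 0)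
    {N : ℕ} {KL : ℕ → ℕ → ℕ → ℝ}
    (hKL : ∀ k n l, KL k n l = if 0 < k ∧ k < K ∧ l < k then L k * h (n + k) ^ 3 / 2 * ∏ t ∈ Ico (n + 1 + l) (n + k + 1), g t else 0)
    {KA : ℕ → ℕ → ℕ → ℝ} {RA : ℕ → (ℕ → ℝ) → ℕ → ℝ}
    (hRA : ∀ i v m, RA i v m = ∑ l ∈ range K, KA i m l * v (m + 1 + l))
    (hKA : ∀ i m l, KA i m l = KL i m l + KA (i + 1) m l) (hKAtop : ∀ m l, KA K m l = 0)
    {e ε : ℕ → ℝ} (he0 : ∀ m, 0 ≤ e m) (hea : ∀ m, e (m + 1) ≤ e m)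
    (hεt : ∀ m, N < m → ε m = 0) (hεrec : ∀ m, ε m = e m - RA 1 ε m) : ∀ m, 0 ≤ ε m ∧ ε m ≤ e m := by
  rcases le_or_gt k₂ 29 with h29 | h30
  · exact flow_nonneg_census_five_ages_top8 hmono hL hb hlo hdom hh hf hg hgF hk2 h29 hk3 h34l h34h h45l h45h hk5K hLa hKL hRA hKA hKAtop he0 hea hεt hεrec
  · exact flow_nonneg_census_five_ages_top8_far hmono hL hb hlo hdom hh hf hg hgF (by omega) hk3 h34l h34h h45l h45h hk5K hLa hKL hRA hKA hKAtop he0 hea hεt hεrec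

end Summit.QuantumFields.BalabanUV.Beta.EriceRemainderEnclosureHistoryAutonomyComparisonAgeCompositionFiveAgesFar
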